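import Literature.NumberTheory.Transcendental.NesterenkoEliminationProp413Proofs
import Literature.NumberTheory.Transcendental.NesterenkoEliminationProp44Holds
import HarnessLib

/-!
# LNM 1752 Ch. 3 Proposition 4.13 (the zero of `I` closest to `ω̄`) — the discharge `…prop_4_13_holds`

Topic `Literature/NumberTheory/Transcendental`. Proofs only (no definitions, no named facts). This
file discharges the named fact `NesterenkoPhilippon2001_ch3_prop_4_13` of
`NesterenkoEliminationFacts.lean` — Yu. V. Nesterenko's Proposition 4.13 in Nesterenko–Philippon
(eds.), LNM 1752 (2001), Ch. 3 §4, p. 41 (`K = ℚ`, `ν = 1`): for a homogeneous unmixed ideal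
`I ⊂ ℚ[x₀, …, x_m]` with `r = 1 + dim I`, `1 ≤ r ≤ m`, and any `ω̄ ∈ ℂ^{m+1} ∖ 0` there is a zero
`β̄ ∈ V(I)` with

  `‖ω̄ − β̄‖^{deg I} ≤ (|I(ω̄)| e^{h(I)})^{1/r} e^{4 m³ deg I}`,

i.e. `deg I · log ‖ω̄ − β̄‖ ≤ (1/r) log |I(ω̄)| + (1/r) h(I) + 4 m³ deg I` (the book prints no proof:
"See [Nes10, Proposition 1.5]").

The proof is the composition of two theorems of the tree:

* `NesterenkoPhilippon2001_ch3_prop_4_13_of_prop_4_4` (`NesterenkoEliminationProp413Proofs.lean`) —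
  Proposition 4.13 follows from Proposition 4.4 (`Ī(r)` principal, generated by the product of the
  associated forms of the associated primes with the exponents of the primary components), by the
  one-block estimate for a product of linear forms in the skew variables, the block step along the
  specialisations `uᵢ ↦ S⁽ⁱ⁾ω̄`, and a pigeonhole over the `r` blocks (see that file's docstring);
* `NesterenkoPhilippon2001_ch3_prop_4_4_holds` (`NesterenkoEliminationProp44Holds.lean`) — the
  discharge of Proposition 4.4.

With this file the trust base of Nesterenko's criterion (Ch. 3 Thm. 5.1 / Philippon's criterion as
assembled in `PhilipponCriterionMain.lean`) and of the Diaz ladder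
(`DiazLadderOfCriterion.lean`, `diaz_1989_of_nesterenko`) loses the leaf Prop. 4.13; of the three
Ch. 3 §4 inputs `prop_4_4 / prop_4_11 / prop_4_13` only Proposition 4.11 (the Bézout step) remains
a named fact.

## References

* [NesterenkoPhilippon2001] Yu. V. Nesterenko, P. Philippon (eds.), *Introduction to Algebraic
  Independence Theory*, Lecture Notes in Math. 1752, Springer 2001, Ch. 3 (Yu. V. Nesterenko,
  *Algebraic fundamentals*) §4, Prop. 4.4 (p. 38), Prop. 4.13 (p. 41); PDF page = book page + 12.
* [Nes10] Yu. V. Nesterenko, *On the measure of algebraic independence of values of Ramanujan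
  functions*, Proc. Steklov Inst. Math. 218 (1997) 294–331, Prop. 1.5 (the printed proof reference).
-/

namespace Literature.NumberTheory.Transcendental

namespace Nesterenko

/-- **LNM 1752 Ch. 3 Proposition 4.13** (`K = ℚ`, `ν = 1`), discharged: for a homogeneous unmixed
ideal `I ⊂ ℚ[x₀, …, x_m]`, `r = 1 + dim I`, `1 ≤ r ≤ m`, and `ω̄ ∈ ℂ^{m+1} ∖ 0` there is a zero `β̄`
of `I` with `‖ω̄ − β̄‖^{deg I} ≤ (|I(ω̄)| e^{h(I)})^{1/r} e^{4 m³ deg I}`. Proof: Proposition 4.13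
from Proposition 4.4 (`NesterenkoPhilippon2001_ch3_prop_4_13_of_prop_4_4`) and the discharge of
Proposition 4.4 (`NesterenkoPhilippon2001_ch3_prop_4_4_holds`).
[cite: NesterenkoPhilippon2001, Ch. 3 Prop. 4.13 (p. 41)] -/
theorem NesterenkoPhilippon2001_ch3_prop_4_13_holds : NesterenkoPhilippon2001_ch3_prop_4_13 :=
  NesterenkoPhilippon2001_ch3_prop_4_13_of_prop_4_4 NesterenkoPhilippon2001_ch3_prop_4_4_holds

end Nesterenko

end Literature.NumberTheory.Transcendental
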